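import Summits.Ventures.HodgeRepro.FaceCensusRows8
import Summits.Ventures.HodgeRepro.EngineBridge
import Summits.Ventures.HodgeRepro.Night1Faces6Cyclic

/-!
# The sealed link for the row `Sextic.Cyclic`: each `FaceData` of the table IS the sealed representative

Blind re-derivation cell `pub-hodge-repro`, seat `night-1` (GENERATED by `bin/gen_sealed_link.py`).  For each sealed
representative `(Φ, π, π′)` of `Sextic.Cyclic.reps` (the `n`-th entry, `face<n>_rep`), the engine's corners
`Γ.corners` are the four masks recorded (`face<n>_corners`), and the model face `(face<n>).face` of
`Night1Faces6Cyclic.lean` is the image of those masks' finsets (p2's `EngineBridge.finsetOf`) under the sealed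
dictionary `enum` (`face<n>_sealed`) — all by `decide`.  So the table's faces are the sealed census's faces, read
through the sealed dictionary; nothing here says anything about the status of the Hodge conjecture for CM abelian
varieties, which is NOT proved.
-/

open Finset
open scoped Pointwise

namespace HodgeRepro.RouteC

namespace Faces6Cyclic

open Summit.Ventures.HodgeRepro.FaceCensus

/-- The sealed dictionary `enum` of the row, into typer's group `C6`. -/
def sealedEnum : Fin 6 → C6 := fun i => Multiplicative.ofAdd (Sextic.Cyclic.enum i)

/-- Face 0 is the sealed representative number 0. -/
theorem face0_rep : Sextic.Cyclic.reps.getD 0 (0, 0, 0) = (7, 9, 18) := by decide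

/-- The engine's corners of the sealed representative 0. -/
theorem face0_corners : Sextic.Cyclic.Γ.corners (7, 9, 18) = [7, 49, 42, 28] := by decide

/-- **The model face 0 is the sealed face 0**: corner by corner, the image of the engine's mask under `enum`. -/
theorem face0_sealed : ∀ i : Fin 4, (face0).face cc_C6 i =
    (EngineBridge.finsetOf Sextic.Cyclic.Γ ((Sextic.Cyclic.Γ.corners (7, 9, 18)).getD i.val 0)).image
      (fun e => sealedEnum (EngineBridge.Elt.idx Sextic.Cyclic.Γ e)) := by decide

end Faces6Cyclic

end HodgeRepro.RouteC
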